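import Summits.Ventures.QEC.Census.BB.BB288.CoverLogicals
import Summits.Ventures.QEC.Census.CertCheckBZFastP
import HarnessLib

set_option Elab.async false

/-!
# `[[288,12,18]]` cover certificate — DATA 1b2: `logOK 288` for the 288 bases and the fast 288-bit label check
The bit-serial `popc 288` costs ≈ 0.4 s per call in the kernel (a plain `logOK 288 …` decide exceeds the budget); here every
288-bit overlap parity goes through `pair288` = two word-parallel 144-bit popcounts (`popcR18` of `CertCheckBZFastP`, exact by
`popcFold_eq_popc`), bridged back to `popc 288` (`pair288_eq`), so `logOK288` elaborates in seconds; `labelCheckOK288` is the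
same device for the level-1→0 label checks (`labelCheckOK_of_288`).
-/

namespace Summit.Ventures.QEC.Census.BB288Cover

open Summit.Ventures.QEC.Census

set_option exponentiation.threshold 512

/-! ## Fast parities of 288-bit words (two word-parallel 144-bit popcounts) -/

/-- Parity of `|a ∩ b|` for words below `2^288`, by halves through `popcR18` (`CertCheckBZFastP`). (definition) -/
def pair288 (a b : ℕ) : ℕ := (popcR18 ((a &&& b) % 2 ^ 144) + popcR18 ((a &&& b) / 2 ^ 144)) % 2

/-- Fast `H v = 0` over 288-bit rows. (definition) -/
def synZ288 (H : List ℕ) (v : ℕ) : Bool := H.all fun h => pair288 h v == 0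

/-- The halves formula is the bit count below `2^288`. -/
theorem popc288_halves {x : ℕ} (hx : x < 2 ^ 288) :
    popcR18 (x % 2 ^ 144) + popcR18 (x / 2 ^ 144) = popc 288 x := by
  have h144 : (2 : ℕ) ^ 288 = 2 ^ 144 * 2 ^ 144 := by rw [← pow_add]
  have hdiv : x / 2 ^ 144 < 2 ^ 144 := Nat.div_lt_of_lt_mul (h144 ▸ hx)
  have hmod : x % 2 ^ 144 < 2 ^ 144 := Nat.mod_lt _ (Nat.two_pow_pos _)
  have e1 : popcR18 (x % 2 ^ 144) = popc 144 (x % 2 ^ 144) := by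
    rw [popcR18_eq]; exact popcFold_eq_popc (by norm_num) hmod
  have e2 : popcR18 (x / 2 ^ 144) = popc 144 (x / 2 ^ 144) := by
    rw [popcR18_eq]; exact popcFold_eq_popc (by norm_num) hdiv
  have e3 : popc 288 x = popc 144 x + popc 144 (x / 2 ^ 144) := popc_add 144 144 x
  have e4 : popc 144 x = popc 144 (x % 2 ^ 144) := by
    conv_lhs => rw [← Nat.mod_add_div x (2 ^ 144)]
    exact popc_add_mul_two_pow 144 _ _
  rw [e1, e2, e3, e4]

/-- `pair288 a b = |a ∩ b| mod 2` for `a < 2^288`. -/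
theorem pair288_eq {a : ℕ} (ha : a < 2 ^ 288) (b : ℕ) : pair288 a b = popc 288 (a &&& b) % 2 := by
  rw [pair288, popc288_halves (lt_of_le_of_lt Nat.and_le_left ha)]

/-- The fast syndrome check agrees with `synZero 288` on rows below `2^288`. -/
theorem synZ288_eq {H : List ℕ} (hH : ∀ h ∈ H, h < 2 ^ 288) (v : ℕ) : synZ288 H v = synZero 288 H v := by
  induction H with
  | nil => simp only [synZ288, synZero, List.all_nil]
  | cons h t ih =>
    have ih' := ih (fun x hx => hH x (List.mem_cons_of_mem _ hx))
    unfold synZ288 synZero at ih' ⊢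
    rw [List.all_cons, List.all_cons, pair288_eq (hH h List.mem_cons_self), ih']

/-! ## The decided facts (fast form) -/

/-- Rows of `H^X₂₈₈`, `H^Z₂₈₈` and the logical words are below `2^288`. -/
theorem words288_lt : (bb288HX.all fun h => decide (h < 2 ^ 288)) = true ∧ (bb288HZ.all fun h => decide (h < 2 ^ 288)) = true ∧
    (LZ288.all fun h => decide (h < 2 ^ 288)) = true := by
  refine ⟨?_, ?_, ?_⟩ <;> decide +kernel

/-- Fast form: every `Z`-logical has zero `H^X₂₈₈`-syndrome, every dual word zero `H^Z₂₈₈`-syndrome. -/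
theorem syn288_fast : ((List.range 12).all fun i => synZ288 bb288HX (LZ288.getD i 0)) = true ∧
    ((List.range 12).all fun i => synZ288 bb288HZ (LX288.getD i 0)) = true := by
  refine ⟨?_, ?_⟩ <;> decide +kernel

/-- Fast form of the 12 × 12 pairing table. -/
theorem pairs288_fast : ((List.range 12).all fun i => (List.range 12).all fun j =>
    pair288 (LZ288.getD i 0) (LX288.getD j 0) == if i = j then 1 else 0) = true := by
  decide +kernel

/-! ## `logOK 288` assembled -/

/-- Unpacking a decided `all (< 2^288)`. -/
theorem lt_of_all_lt {L : List ℕ} (h : (L.all fun x => decide (x < 2 ^ 288)) = true) : ∀ x ∈ L, x < 2 ^ 288 := by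
  simpa [List.all_eq_true] using h

/-- `getD` of a bounded list is bounded. -/
theorem getD_lt_of_all_lt {L : List ℕ} (h : ∀ x ∈ L, x < 2 ^ 288) (i : ℕ) : L.getD i 0 < 2 ^ 288 := by
  rw [List.getD_eq_getElem?_getD]
  cases hi : L[i]? with
  | none => exact Nat.two_pow_pos _
  | some x => exact h x (List.mem_of_getElem? hi)

/-- The 12 × 12 pairing table `⟨LZ288_i, LX288_j⟩ = δ_ij` (popcount form). -/
theorem pairs288 : ((List.range 12).all fun i => (List.range 12).all fun j =>
    popc 288 (LZ288.getD i 0 &&& LX288.getD j 0) % 2 == if i = j then 1 else 0) = true := by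
  have hZ := getD_lt_of_all_lt (lt_of_all_lt words288_lt.2.2)
  have h := pairs288_fast
  simp only [List.all_eq_true, List.mem_range, beq_iff_eq] at h ⊢
  intro i hi j hj
  rw [← pair288_eq (hZ i)]
  exact h i hi j hj

/-- **Pairing check of the 288 bases** (`logOK`, CERT-FORMAT O4), assembled from the fast facts. -/
theorem logOK288 : logOK 288 bb288HX bb288HZ LZ288 LX288 = true := by
  have hHX := lt_of_all_lt words288_lt.1
  have hHZ := lt_of_all_lt words288_lt.2.1
  have hs := syn288_fast
  simp only [List.all_eq_true, List.mem_range] at hs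
  have hZ : ∀ i, i < 12 → synZero 288 bb288HX (LZ288.getD i 0) = true := fun i hi => by
    rw [← synZ288_eq hHX]; exact hs.1 i hi
  have hX : ∀ i, i < 12 → synZero 288 bb288HZ (LX288.getD i 0) = true := fun i hi => by
    rw [← synZ288_eq hHZ]; exact hs.2 i hi
  have hlz : LZ288.length = 12 := by decide
  have hlx : LX288.length = 12 := by decide
  unfold logOK
  rw [hlz]
  simp only [Bool.and_eq_true, beq_iff_eq, hlx, pairs288, and_true, true_and]
  constructor
  · rw [List.all_eq_true]
    intro x hx
    obtain ⟨i, hi, rfl⟩ := List.getElem_of_mem hx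
    have := hZ i (by rw [hlz] at hi; exact hi)
    rwa [List.getD_eq_getElem?_getD, List.getElem?_eq_getElem hi, Option.getD_some] at this
  · rw [List.all_eq_true]
    intro x hx
    obtain ⟨i, hi, rfl⟩ := List.getElem_of_mem hx
    have := hX i (by rw [hlx] at hi; exact hi)
    rwa [List.getD_eq_getElem?_getD, List.getElem?_eq_getElem hi, Option.getD_some] at this


/-! ## Fast label check (288-bit functionals) -/

/-- The LABEL CHECK of `CertCoverChecks.labelCheckOK` with the 288-bit overlap parity taken through `pair288`.
(definition) -/
def labelCheckOK288 (c : Cover2) (P : CosetProb) (u : ℕ) (Lam : List ℕ) : Bool :=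
  P.allow.all fun a => Lam.all fun l =>
    (pair288 l (c.lift0 u) + popc c.nq (c.push l &&& (P.y0 ^^^ xorSel P.G (selOf P.T a)))) % 2 == 0

/-- The fast label check implies the generic one when the cover has `n = 288` and the functionals are below `2^288`. -/
theorem labelCheckOK_of_288 {c : Cover2} (hn : c.n = 288) {P : CosetProb} {u : ℕ} {Lam : List ℕ}
    (hL : ∀ l ∈ Lam, l < 2 ^ 288) (h : labelCheckOK288 c P u Lam = true) : labelCheckOK c P u Lam = true := by
  simp only [labelCheckOK288, List.all_eq_true, beq_iff_eq] at h
  simp only [labelCheckOK, List.all_eq_true, beq_iff_eq]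
  intro a ha l hl
  have := h a ha l hl
  rw [pair288_eq (hL l hl), Nat.add_mod, Nat.mod_mod, ← Nat.add_mod] at this
  rw [hn]
  exact this

/-- The dual words are below `2^288`. -/
theorem LX288_lt : ∀ l ∈ LX288, l < 2 ^ 288 := by
  have h : (LX288.all fun x => decide (x < 2 ^ 288)) = true := by decide +kernel
  simpa [List.all_eq_true] using h

end Summit.Ventures.QEC.Census.BB288Cover
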